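import Summits.CriticalPhenomena.SAWScalingLimit.Theses.SAWDefectDecoherence
import Summits.CriticalPhenomena.SAWScalingLimit.Theorems.SAWDefectDecoherenceBoundaryClosureRIdentificationOfTarget
import HarnessLib

/-!
# `BoundaryClosureR`, line `pick-half-plane` (r15): the model input `GateTraceH` is NECESSARY
(crux stmt-CriticalPhenomena-14004, stub `stub_gateTraceH_necessity`; registered sub-goal
`gateTraceH_of_target`)

The r15 skeleton reduces the crux `BoundaryClosureR := DefectDecoherence → MassRatio →
HexObservableLimitR` to two model inputs; the second, `GateTraceH`, says that with ONE universal
`c ≠ 0`, for every admissible datum (Dobrushin domain flat near the normaliser `D.pt 1`, admissible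
discretisation family, root pinned at `D.pt 0`, admissible conformal datum `(Φ, L, L_b)`), every
mesh sequence `ns → 0⁺` and every function `g` HOLOMORPHIC on the carrier which is the weak limit of
the normalised bulk functionals `N_δ(ψ) := δ² (Σ_e ψ(δ·mid e) F_δ(e)) / F_δ(b_δ)` along `ns`, the
function `g · exp(−(5/8)(L − L_b))` tends to `c` within the carrier at every point of the flat gate
`{im z = im (D.pt 1)} ∩ B(D.pt 1, ρ)`.

THEOREM (`gateTraceH_of_target`, the skeleton's `GateTraceH` UNFOLDED verbatim): the target
`HexObservableLimitR` implies it, with the target's own constant `c`.  Proof: the landed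
identification of weak limits by the target (`weakLimit_eq_of_hexObservableLimitR`, p83707:
repackage the datum with the common pin radius `min ρ r₀` and pins `![m₀, m]`, feed it to the
target, `N_δ(ψ) → c ∫ ψ e^{(5/8)(L − L_b)}` along `𝓝[>] 0` hence along `ns`, the weak limit gives
`N_{ns n}(ψ) → ∫ ψ g`, uniqueness of limits and the fundamental lemma for continuous tests) yields
`g = c · e^{(5/8)(L − L_b)}` on the carrier; there `g · e^{−(5/8)(L − L_b)} ≡ c`, so the gate trace is
the constant `c` (`Filter.Tendsto.congr'` within the carrier).  Only continuity of `g` on the open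
carrier is used.  No new definitions.
-/

noncomputable section

open scoped Topology
open Filter Set MeasureTheory
open Literature.Probability.LatticeModels Literature.Probability.RandomPlanarGeometry
open Literature.Probability.RandomPlanarGeometry.SAW
open Summit.CriticalPhenomena.SAWScalingLimit.Theses.SAWDefectDecoherence

namespace Summit.CriticalPhenomena.SAWScalingLimit.Theorems.PickHalfPlane.Identification

/-- **Necessity of `GateTraceH`** (registered sub-goal `gateTraceH_of_target` of the stub
`stub_gateTraceH_necessity`, r15): the target `HexObservableLimitR` forces every holomorphic weak
limit `g` of the normalised bulk functionals along a mesh sequence to be `c · exp((5/8)(L − L_b))`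
on the carrier (uniqueness of weak limits, `weakLimit_eq_of_hexObservableLimitR`), so
`g · exp(−(5/8)(L − L_b)) → c` within the carrier at every point of the flat gate — with the
target's universal constant `c ≠ 0`. [folklore] -/
theorem gateTraceH_of_target :
    HexObservableLimitR →
    ∃ c : ℂ, c ≠ 0 ∧
    ∀ (D : DobrushinDomain) (ρ : ℝ) (Λ : ℝ → Finset HexVertex) (m : ℝ → ℤ) (b : ℝ → Sym2 HexVertex),
      (0 < ρ ∧
        D.carrier ∩ Metric.ball (D.pt 1) ρ = {z : ℂ | (D.pt 1).im < z.im} ∩ Metric.ball (D.pt 1) ρ ∧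
        (∀ᶠ δ : ℝ in 𝓝[>] 0, hexDomainSimplyConnected (Λ δ) ∧ b δ ∈ hexDomainBoundary (Λ δ) ∧
            (hexGraph.induce ((Λ δ : Finset HexVertex) : Set HexVertex)).Preconnected ∧
            (∀ v ∈ Λ δ, (δ : ℂ) * hexCenter v ∈ D.carrier) ∧
            (∀ v : HexVertex, (δ : ℂ) * hexCenter v ∈ Metric.ball (D.pt 1) ρ →
              (v ∈ Λ δ ↔ m δ ≤ v.1 1))) ∧
        (∀ K : Set ℂ, IsCompact K → K ⊆ D.carrier →
            ∀ᶠ δ : ℝ in 𝓝[>] 0, ∀ v : HexVertex, (δ : ℂ) * hexCenter v ∈ K → v ∈ Λ δ) ∧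
        Tendsto (fun δ : ℝ => (δ : ℂ) * hexMidpoint (b δ)) (𝓝[>] 0) (𝓝 (D.pt 1))) →
    ∀ (a : ℝ → Sym2 HexVertex) (r₀ : ℝ) (m₀ : ℝ → ℤ),
      (0 < r₀ ∧
        D.carrier ∩ Metric.ball (D.pt 0) r₀ = {z : ℂ | (D.pt 0).im < z.im} ∩ Metric.ball (D.pt 0) r₀ ∧
        (∀ᶠ δ : ℝ in 𝓝[>] 0, a δ ∈ hexDomainBoundary (Λ δ) ∧
            Nonempty (HexMidEdgeSAW (Λ δ) (a δ) (b δ)) ∧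
            (∀ v : HexVertex, (δ : ℂ) * hexCenter v ∈ Metric.ball (D.pt 0) r₀ →
              (v ∈ Λ δ ↔ m₀ δ ≤ v.1 1))) ∧
        Tendsto (fun δ : ℝ => (δ : ℂ) * hexMidpoint (a δ)) (𝓝[>] 0) (𝓝 (D.pt 0))) →
    ∀ (Φ : ConformalEquiv D.carrier UpperHalfPlane.upperHalfPlaneSet) (L : ℂ → ℂ) (Lb : ℂ),
      Tendsto (fun z => ‖Φ z‖) (𝓝[D.carrier] (D.pt 0)) atTop → Φ.HasBoundaryValue (D.pt 1) 0 →
      ContinuousOn L D.carrier → (∀ z ∈ D.carrier, Complex.exp (L z) = deriv Φ z) →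
      Tendsto L (𝓝[D.carrier] (D.pt 1)) (𝓝 Lb) →
    ∀ ns : ℕ → ℝ, Tendsto ns atTop (𝓝[>] 0) →
    ∀ g : ℂ → ℂ, DifferentiableOn ℂ g D.carrier →
      (∀ ψ : ℂ → ℂ, (Continuous ψ ∧ HasCompactSupport ψ ∧ tsupport ψ ⊆ D.carrier) →
        Tendsto (fun n => ((ns n : ℝ) : ℂ) ^ 2 * (∑ᶠ z ∈ hexDomainMidEdges (Λ (ns n)),
            ψ (((ns n : ℝ) : ℂ) * hexMidpoint z) *
              hexParafermionicObservable (Λ (ns n)) (a (ns n)) hexCriticalFugacity (5 / 8) z) /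
          hexParafermionicObservable (Λ (ns n)) (a (ns n)) hexCriticalFugacity (5 / 8) (b (ns n)))
          atTop (𝓝 (∫ z, ψ z * g z))) →
      ∀ y : ℂ, y.im = (D.pt 1).im → y ∈ Metric.ball (D.pt 1) ρ →
        Tendsto (fun z => g z * Complex.exp (-((5 / 8 : ℂ) * (L z - Lb)))) (𝓝[D.carrier] y) (𝓝 c) := by
  rintro ⟨c, hc, hX⟩
  refine ⟨c, hc, ?_⟩
  intro D ρ Λ m b hAF a r₀ m₀ hPR Φ L Lb hΦ0 hΦ1 hL hexpL hLb ns hns g hg hWL y _hy _hyρ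
  -- the target identifies the weak limit on the whole carrier
  have heq : ∀ z ∈ D.carrier, g z = c * Complex.exp ((5 / 8 : ℂ) * (L z - Lb)) :=
    weakLimit_eq_of_hexObservableLimitR hX D ρ Λ m b hAF a r₀ m₀ hPR Φ L Lb hΦ0 hΦ1 hL hexpL hLb
      ns hns g hg.continuousOn hWL
  -- so `g · e^{−(5/8)(L − L_b)} ≡ c` on the carrier, in particular it tends to `c` within it
  have hconst : ∀ z ∈ D.carrier, g z * Complex.exp (-((5 / 8 : ℂ) * (L z - Lb))) = c := by
    intro z hz
    rw [heq z hz, mul_assoc, ← Complex.exp_add, add_neg_cancel, Complex.exp_zero, mul_one]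
  have hEv : (fun z => g z * Complex.exp (-((5 / 8 : ℂ) * (L z - Lb)))) =ᶠ[𝓝[D.carrier] y]
      fun _ => c :=
    eventually_nhdsWithin_of_forall hconst
  exact tendsto_const_nhds.congr' hEv.symm

end Summit.CriticalPhenomena.SAWScalingLimit.Theorems.PickHalfPlane.Identification

end
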